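import Mathlib
import Summits.CriticalPhenomena.PercolationContinuityZ3.Theorems.PercNearOneGluingNoHeavyLowerTailKnQuestion8AntitheticTowerWorld

/-!
# The source tower calculus, III: Boolean side facts, closed configurations, and the `τ`-side bound `W ≥ −1`

Support file (seat `prim-ineq-gen-7` gen 31; helper for `stmt-CriticalPhenomena-4575`).  No `sorry`.
Memo: run/shared/lean/prim/prim-ineq-gen-7/PROOF-TOWER-g31.md §5 (W).  `W_bound`: for the `F′`-top configuration of a hub level with
true routes `B`, instance routes `AL`, memberships `U`:  `T4(B;U;D) − min_H T4(AL;U;H·D) ≥ −1`, with equality only in the characterized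
case `charW B AL` (some type `t` with `AL ⊇ ρ_t`, `B ⊉ ρ_t`, `B ∪ AL` open for `t`).

* `AntitheticTower.W_bound`.
-/

namespace Summit.CriticalPhenomena.PercolationContinuityZ3.Theorems

namespace AntitheticTower

/-! ### Closed configurations (no open node) have no certificates (type-t world) -/

/-- All sources closed (monochrome). -/
def closedM : (k : ℕ) → Cfg k → Bool
  | 0, .nil => true
  | k + 1, .node v h t => !v.o && closedM k h && closedM k t

/-- Closedness is preserved by handing (monochrome). -/
theorem closedM_hands : ∀ (k : ℕ) (D D' : Cfg k), closedM k D = true → D' ∈ hands k D → closedM k D' = true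
  | 0, .nil, .nil, _, _ => rfl
  | k + 1, .node v h t, D', hD, hD' => by
      simp only [hands, List.mem_flatMap, List.mem_map, Src.hands, List.mem_cons, List.mem_nil_iff, or_false] at hD'
      obtain ⟨v', hv', h', hh', t', ht', rfl⟩ := hD'
      simp only [closedM, Bool.and_eq_true, Bool.not_eq_true'] at hD ⊢
      refine ⟨⟨?_, closedM_hands k h h' hD.1.2 hh'⟩, closedM_hands k t t' hD.2 ht'⟩
      rcases hv' with rfl | rfl | rfl <;> exact hD.1.1

/-- A closed root over a closed configuration has value 0 (monochrome). -/
theorem T_closed : ∀ (k : ℕ) (r : Rt) (z : Bool) (D : Cfg k), closedM k D = true → T k r false z D = 0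
  | 0, r, z, .nil, _ => by simp [T, bi]
  | k + 1, r, z, .node v h t, hD => by
      simp only [closedM, Bool.and_eq_true, Bool.not_eq_true'] at hD
      obtain ⟨⟨hv, hh⟩, ht⟩ := hD
      simp only [T, hv]
      rw [T_closed k _ z h hh, T_closed k r v.z t ht]
      have hz : lmin ((hands k t).map fun t' => T k v.lam false v.z t') = 0 := by
        apply lmin_const_zero _ _ (hands_ne_nil k t)
        intro u hu; exact T_closed k v.lam v.z u (closedM_hands k t u ht hu)
      rw [hz]; simp

/-- … hence `C = 0` for a closed root over a closed configuration. -/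
theorem C_closed (k : ℕ) (r r' : Rt) (z : Bool) (D : Cfg k) (hD : closedM k D = true) : C k r r' false z D = 0 := by
  obtain ⟨D', hD', hval⟩ := m_attained k r' false z D
  simp only [C, hval, T_closed k r z D hD, T_closed k r' z D' (closedM_hands k D D' hD hD')]; simp



/-! ### Boolean side facts (all by `decide`) -/

/-- `touch` is monotone. -/
theorem touch_mono (t : Bool) (x s : Q4) (h : Q4.sub x s = true) (hx : touch t x = true) : touch t s = true := by
  rcases x with ⟨x1, x2, x3, x4⟩; rcases s with ⟨s1, s2, s3, s4⟩; revert h hx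
  cases t <;> cases x1 <;> cases x2 <;> cases x3 <;> cases x4 <;> cases s1 <;> cases s2 <;> cases s3 <;> cases s4 <;> decide

/-- `opn` is antitone. -/
theorem opn_anti (t : Bool) (x s : Q4) (h : Q4.sub x s = true) (hs : opn t s = true) : opn t x = true := by
  rcases x with ⟨x1, x2, x3, x4⟩; rcases s with ⟨s1, s2, s3, s4⟩; revert h hs
  cases t <;> cases x1 <;> cases x2 <;> cases x3 <;> cases x4 <;> cases s1 <;> cases s2 <;> cases s3 <;> cases s4 <;> decide

/-- `inside` is antitone. -/
theorem inside_anti (t : Bool) (x s : Q4) (h : Q4.sub x s = true) (hs : inside t s = true) : inside t x = true := by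
  rcases x with ⟨x1, x2, x3, x4⟩; rcases s with ⟨s1, s2, s3, s4⟩; revert h hs
  cases t <;> cases x1 <;> cases x2 <;> cases x3 <;> cases x4 <;> cases s1 <;> cases s2 <;> cases s3 <;> cases s4 <;> decide

/-- `full ∘ pr` is monotone. -/
theorem full_pr_mono (t : Bool) (x s : Q4) (h : Q4.sub x s = true) (hx : full (pr t x) = true) : full (pr t s) = true := by
  rcases x with ⟨x1, x2, x3, x4⟩; rcases s with ⟨s1, s2, s3, s4⟩; revert h hx
  cases t <;> cases x1 <;> cases x2 <;> cases x3 <;> cases x4 <;> cases s1 <;> cases s2 <;> cases s3 <;> cases s4 <;> decide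

/-- A nonzero vector inside type `t` touches type `t`. -/
theorem touch_of_inside (t : Bool) (x : Q4) (hx : inside t x = true) (hne : x ≠ Q4.zero) : touch t x = true := by
  rcases x with ⟨x1, x2, x3, x4⟩; revert hx hne
  cases t <;> cases x1 <;> cases x2 <;> cases x3 <;> cases x4 <;> decide

/-- Every own route vector lies below the union `lamU4`. -/
theorem alls_sub_lamU4 : ∀ (k : ℕ) (D : Cfg4 k) (L : Q4), Q4.sub (lamU4 k D) L = true → alls k D (fun v => Q4.sub v.l L) = true
  | 0, .nil, _, _ => rfl
  | k + 1, .node v h t, L, hL => by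
      simp only [alls, Bool.and_eq_true]
      have hs : ∀ x y : Q4, Q4.sub (Q4.sup x y) L = true → Q4.sub x L = true ∧ Q4.sub y L = true := by
        intro x y hxy
        rcases x with ⟨x1, x2, x3, x4⟩; rcases y with ⟨y1, y2, y3, y4⟩; rcases L with ⟨l1, l2, l3, l4⟩; revert hxy
        cases x1 <;> cases x2 <;> cases x3 <;> cases x4 <;> cases y1 <;> cases y2 <;> cases y3 <;> cases y4 <;>
          cases l1 <;> cases l2 <;> cases l3 <;> cases l4 <;> decide
      simp only [lamU4] at hL
      obtain ⟨h1, h23⟩ := hs _ _ hL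
      obtain ⟨h2, h3⟩ := hs _ _ h23
      exact ⟨⟨h1, alls_sub_lamU4 k h L h2⟩, alls_sub_lamU4 k t L h3⟩

/-- `Q4.sub` is reflexive. -/
theorem Q4.sub_refl (x : Q4) : Q4.sub x x = true := by
  rcases x with ⟨x1, x2, x3, x4⟩; cases x1 <;> cases x2 <;> cases x3 <;> cases x4 <;> decide

/-- `alls` is monotone in the predicate. -/
theorem alls_mono {p q : Src4 → Bool} (hpq : ∀ v, p v = true → q v = true) : ∀ (k : ℕ) (D : Cfg4 k), alls k D p = true → alls k D q = true
  | 0, .nil, _ => rfl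
  | k + 1, .node v h t, hD => by
      simp only [alls, Bool.and_eq_true] at hD ⊢
      exact ⟨⟨hpq v hD.1.1, alls_mono hpq k h hD.1.2⟩, alls_mono hpq k t hD.2⟩

/-- Conjunction of `alls`. -/
theorem alls_and {p q : Src4 → Bool} : ∀ (k : ℕ) (D : Cfg4 k), alls k D p = true → alls k D q = true →
    alls k D (fun v => p v && q v) = true
  | 0, .nil, _, _ => rfl
  | k + 1, .node v h t, hp, hq => by
      simp only [alls, Bool.and_eq_true] at hp hq ⊢
      exact ⟨⟨⟨hp.1.1, hq.1.1⟩, alls_and k h hp.1.2 hq.1.2⟩, alls_and k t hp.2 hq.2⟩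

/-- Below the empty vector only the empty vector. -/
theorem Q4.sub_zero (l : Q4) (h : Q4.sub l Q4.zero = true) : l = Q4.zero := by
  rcases l with ⟨l1, l2, l3, l4⟩; revert h
  cases l1 <;> cases l2 <;> cases l3 <;> cases l4 <;> simp [Q4.sub, Q4.zero]

/-- Below the empty vector means plain. -/
theorem alls_plain_of_lamU4 (k : ℕ) (D : Cfg4 k) (h0 : lamU4 k D = Q4.zero) : alls k D plain = true := by
  have h := alls_sub_lamU4 k D Q4.zero (by rw [h0]; exact Q4.sub_refl _)
  exact alls_mono (fun v hv => by simp only [plain, decide_eq_true_eq]; exact Q4.sub_zero v.l hv) k D h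

/-- The projected union of routes is the union of the projected routes. -/
theorem lamU_prD (t : Bool) : ∀ (k : ℕ) (D : Cfg4 k), lamU k (prD t k D) = pr t (lamU4 k D)
  | 0, .nil => by simp [lamU, prD, lamU4, pr_zero]
  | k + 1, .node v h t' => by simp [lamU, prD, lamU4, prS, pr_sup, lamU_prD t k h, lamU_prD t k t']

/-- In the type-`t` world a configuration whose memberships contain a non-open vector is closed. -/
theorem closedM_prD (t : Bool) (X : Q4) (hX : opn t X = false) :
    ∀ (k : ℕ) (D : Cfg4 k), alls k D (fun v => Q4.sub X v.s) = true → closedM k (prD t k D) = true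
  | 0, .nil, _ => rfl
  | k + 1, .node v h t', hD => by
      simp only [alls, Bool.and_eq_true] at hD
      simp only [closedM, prD, prS, Bool.and_eq_true, Bool.not_eq_true']
      refine ⟨⟨?_, closedM_prD t X hX k h hD.1.2⟩, closedM_prD t X hX k t' hD.2⟩
      by_contra hc
      have ho : opn t v.s = true := by simpa using hc
      have := opn_anti t X v.s hD.1.1 ho
      rw [hX] at this; exact Bool.false_ne_true this

/-- A certificate has a type: full routes and open memberships of that type. -/
theorem cert4_cases (r s : Q4) (h : cert4 r s = true) : ∃ t : Bool, full (pr t r) = true ∧ opn t s = true := by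
  rcases r with ⟨r1, r2, r3, r4⟩; rcases s with ⟨s1, s2, s3, s4⟩; revert h
  cases r1 <;> cases r2 <;> cases r3 <;> cases r4 <;> cases s1 <;> cases s2 <;> cases s3 <;> cases s4 <;> decide

/-- Full routes and open memberships of one type give a certificate. -/
theorem cert4_intro (t : Bool) (r s : Q4) (hr : full (pr t r) = true) (hs : opn t s = true) : cert4 r s = true := by
  rcases r with ⟨r1, r2, r3, r4⟩; rcases s with ⟨s1, s2, s3, s4⟩; revert hr hs
  cases t <;> cases r1 <;> cases r2 <;> cases r3 <;> cases r4 <;> cases s1 <;> cases s2 <;> cases s3 <;> cases s4 <;> decide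

/-- Fullness passes to a union (left). -/
theorem full_pr_sup_left (t : Bool) (x y : Q4) (h : full (pr t x) = true) : full (pr t (Q4.sup x y)) = true := by
  rcases x with ⟨x1, x2, x3, x4⟩; rcases y with ⟨y1, y2, y3, y4⟩; revert h
  cases t <;> cases x1 <;> cases x2 <;> cases x3 <;> cases x4 <;> cases y1 <;> cases y2 <;> cases y3 <;> cases y4 <;> decide

/-- Fullness passes to a union (right). -/
theorem full_pr_sup_right (t : Bool) (x y : Q4) (h : full (pr t y) = true) : full (pr t (Q4.sup x y)) = true := by
  rcases x with ⟨x1, x2, x3, x4⟩; rcases y with ⟨y1, y2, y3, y4⟩; revert h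
  cases t <;> cases x1 <;> cases x2 <;> cases x3 <;> cases x4 <;> cases y1 <;> cases y2 <;> cases y3 <;> cases y4 <;> decide

/-- An open, non-full vector has nonnegative product term. -/
theorem prod_nonneg_of_open (t : Bool) (B : Q4) (ho : opn t B = true) (hf : full (pr t B) = false) : 0 ≤ prod4 B := by
  rcases B with ⟨b1, b2, b3, b4⟩; revert ho hf
  cases t <;> cases b1 <;> cases b2 <;> cases b3 <;> cases b4 <;> decide

/-- A vector containing the full routes of one type is not open for the other type. -/
theorem not_opn_other (t : Bool) (AL X : Q4) (hf : full (pr t AL) = true) (hs : Q4.sub AL X = true) : opn (!t) X = false := by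
  rcases AL with ⟨a1, a2, a3, a4⟩; rcases X with ⟨x1, x2, x3, x4⟩; revert hf hs
  cases t <;> cases a1 <;> cases a2 <;> cases a3 <;> cases a4 <;> cases x1 <;> cases x2 <;> cases x3 <;> cases x4 <;> decide

/-- Left part below the union. -/
theorem Q4.sub_sup_left (x y : Q4) : Q4.sub x (Q4.sup x y) = true := by
  rcases x with ⟨x1, x2, x3, x4⟩; rcases y with ⟨y1, y2, y3, y4⟩
  cases x1 <;> cases x2 <;> cases x3 <;> cases x4 <;> cases y1 <;> cases y2 <;> cases y3 <;> cases y4 <;> decide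

/-- Right part below the union. -/
theorem Q4.sub_sup_right (x y : Q4) : Q4.sub y (Q4.sup x y) = true := by
  rcases x with ⟨x1, x2, x3, x4⟩; rcases y with ⟨y1, y2, y3, y4⟩
  cases x1 <;> cases x2 <;> cases x3 <;> cases x4 <;> cases y1 <;> cases y2 <;> cases y3 <;> cases y4 <;> decide

/-- Transitivity of `Q4.sub`. -/
theorem Q4.sub_trans (x y w : Q4) (h1 : Q4.sub x y = true) (h2 : Q4.sub y w = true) : Q4.sub x w = true := by
  rcases x with ⟨x1, x2, x3, x4⟩; rcases y with ⟨y1, y2, y3, y4⟩; rcases w with ⟨w1, w2, w3, w4⟩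
  simp only [Q4.sub, Bool.and_eq_true, Bool.or_eq_true, Bool.not_eq_true'] at h1 h2 ⊢
  revert h1 h2
  cases x1 <;> cases x2 <;> cases x3 <;> cases x4 <;> simp <;> cases y1 <;> cases y2 <;> cases y3 <;> cases y4 <;> simp_all

/-! ### The two halves of the level: `W` (τ_y side against the instance) and `V` (T_y side) -/

/-- Characterization predicate of a τ-side loss. -/
def charW (B AL : Q4) : Bool :=
  (full (pr true AL) && !full (pr true B) && opn true (Q4.sup B AL)) ||
  (full (pr false AL) && !full (pr false B) && opn false (Q4.sup B AL))

/-- Characterization predicate of a T-side loss (routes `X`, memberships `T`). -/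
def charV (X T : Q4) : Bool :=
  (full (pr true T) && !full (pr true X) && opn true X) || (full (pr false T) && !full (pr false X) && opn false X)

/-- `W ≥ −1`, and `W = −1` only in the characterized case. -/
theorem W_bound (k : ℕ) (B AL U : Q4) (zU : Bool) (D : Cfg4 k)
    (hBU : Q4.sub (Q4.sup B AL) U = true) (hf : alls k D (fun v => Q4.sub (Q4.sup B AL) v.s) = true)
    (hLU : Q4.sub (lamU4 k D) U = true) (hLs : alls k D (fun v => Q4.sub (lamU4 k D) v.s) = true) :
    -1 ≤ T4 k B U zU D - m4 k AL U zU D ∧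
    (T4 k B U zU D - m4 k AL U zU D = -1 → charW B AL = true) := by
  set L := lamU4 k D with hLdef
  have hl : alls k D (fun v => Q4.sub v.l L) = true := alls_sub_lamU4 k D L (Q4.sub_refl _)
  by_cases hdead : touch true L = true ∧ touch false L = true
  · -- dead world
    have hU1 := touch_mono true L U hLU hdead.1; have hU2 := touch_mono false L U hLU hdead.2
    have hn : alls k D nocert = true :=
      alls_mono (fun v hv => by
        simp only [nocert, Bool.and_eq_true]; exact ⟨touch_mono true L v.s hv hdead.1, touch_mono false L v.s hv hdead.2⟩) k D hLs
    rw [T4_dead k B U zU D hU1 hU2 hn, m4_dead k AL U zU D hU1 hU2 hn]; simp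
  by_cases hzero : L = Q4.zero
  · -- plain world
    have hp : alls k D plain = true := alls_plain_of_lamU4 k D (by rw [← hLdef, hzero])
    rw [T4_plain k B U zU D hp, m4_plain k AL U zU D hp]
    have hc := csum_nonneg k B D
    have h1 := bi_le_one (zU && cert4 AL U); have h2 := bi_nonneg (zU && cert4 B U)
    refine ⟨by omega, fun he => ?_⟩
    have hA : bi (zU && cert4 AL U) = 1 := by omega
    have hB : bi (zU && cert4 B U) = 0 := by omega
    have hzc : zU = true ∧ cert4 AL U = true := by
      revert hA; cases zU <;> cases cert4 AL U <;> simp [bi]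
    have hcB : cert4 B U = false := by
      revert hB; rw [hzc.1]; cases cert4 B U <;> simp [bi]
    obtain ⟨t, hfA, hoU⟩ := cert4_cases AL U hzc.2
    have hoX : opn t (Q4.sup B AL) = true := opn_anti t _ U hBU hoU
    have hnB : full (pr t B) = false := by
      by_contra hc; have hc' : full (pr t B) = true := by simpa using hc
      have := cert4_intro t B U hc' hoU; rw [hcB] at this; exact Bool.false_ne_true this
    simp only [charW]; cases t <;> simp_all
  · -- type-t world: L inside some type
    have ht : ∃ t : Bool, inside t L = true := by
      rcases L with ⟨l1, l2, l3, l4⟩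
      simp only [touch] at hdead
      refine (?_ : ∃ t : Bool, inside t ⟨l1, l2, l3, l4⟩ = true)
      revert hdead; cases l1 <;> cases l2 <;> cases l3 <;> cases l4 <;> decide
    obtain ⟨t, htL⟩ := ht
    have hLt : touch t L = true := touch_of_inside t L htL hzero
    have hUt : touch t U = true := touch_mono t L U hLU hLt
    have hw : alls k D (worldOK t) = true := by
      have := alls_and k D hLs hl
      exact alls_mono (fun v hv => by
        simp only [Bool.and_eq_true] at hv
        simp only [worldOK, Bool.and_eq_true]
        exact ⟨touch_mono t L v.s hv.1 hLt, inside_anti t v.l L hv.2 htL⟩) k D this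
    rw [T4_world t k B U zU D hUt hw, m4_world t k AL U zU D hUt hw]
    have hcap := cap k (pr t B) (pr t AL) (opn t U) zU (prD t k D)
    simp only [C] at hcap
    have hb1 := bi_le_one (full (pr t AL) && !full (pr t B))
    refine ⟨by omega, fun he => ?_⟩
    have hfull : (full (pr t AL) && !full (pr t B)) = true := by
      by_contra hc
      have : bi (full (pr t AL) && !full (pr t B)) = 0 := by simp [Bool.eq_false_iff.mpr hc, bi]
      omega
    have hopen : opn t (Q4.sup B AL) = true := by
      by_contra hc
      have hX : opn t (Q4.sup B AL) = false := by simpa using hc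
      have hcl : closedM k (prD t k D) = true := closedM_prD t (Q4.sup B AL) hX k D hf
      have hUc : opn t U = false := by
        by_contra hu; have hu' : opn t U = true := by simpa using hu
        have := opn_anti t _ U hBU hu'; rw [hX] at this; exact Bool.false_ne_true this
      have h0 := C_closed k (pr t B) (pr t AL) zU (prD t k D) hcl
      simp only [C, hUc] at h0 he
      omega
    simp only [charW]
    simp only [Bool.and_eq_true, Bool.not_eq_true'] at hfull
    cases t <;> simp_all


end AntitheticTower

end Summit.CriticalPhenomena.PercolationContinuityZ3.Theorems
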